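import Mathlib
import Literature.MathematicalPhysics.QuantumFieldTheory.Balaban1983to89.B15Ineq147Admissible
import Literature.MathematicalPhysics.QuantumFieldTheory.Balaban1983to89.B6Ineq261LevelGap

/-!
# `Balaban1983to89.B15TouchingCubeContours` — the graph of TOUCHING `M₁Lⁿ`-cubes on the ℤᵈ model of
# [Balaban1989LargeFieldI] p. 179 / p. 186 (`B15Ineq147LevelGap.CubeSite`): the walk form of (2.2)/(2.57)
# [Balaban1984PropagatorsII] (`LevelGap (M/M₁)`), CONNECTEDNESS from the partition «T = ⋃_j B^j(Λ_j)» (2.4), and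
# Lemma 2.1 (2.60)–(2.63) [Balaban1984PropagatorsII] for every geometry it realises — a named, inhabited instance of
# `B6Ineq261LevelGap.rowSum_cubeSites` / `lemma21_cubeSites` with `hconn`, `hgap`, `hadj` discharged

statement-level skeleton of published theorems with citation tags; proofs where landed; nothing here is a claim about
the Yang–Mills mass gap

CITATION HEADER (lean-in-tree rule).  T. Bałaban, *Propagators and renormalization transformations for lattice gauge
theories. II*, Commun. Math. Phys. **96** (1984) 223–250 [Balaban1984PropagatorsII] (cell paper B6; PDF held
`paper:balaban1984-cmp96-propagators-rt-ii`, journal page = PDF page + 222; p. 224 = PDF 2, p. 231 = PDF 9, p. 233 = PDF 11,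
p. 234 = PDF 12, text layers `p0002.txt`, `p0009.txt` read by this seat), T. Bałaban, *Large field renormalization. I. The
basic step of the 𝐑 operation*, Commun. Math. Phys. **122** (1989) 175–202 [Balaban1989LargeFieldI] (cell paper B15 = [IV];
PDF held `paper:balaban1989-cmp122-large-field-i`, p. 179 = PDF 5 read by this seat (`p0005.txt`), p. 186 = PDF 12).
WHAT IS REPRODUCED: SKELETON rows **B6.Lem2.1** (owner r03; (2.60)–(2.63), here on a concrete model class), the cube model of
**B15.Eq1.47**/(1.12)–(1.13) p. 179 (owner r12), feeding **B16.Eq1.47** (owner r13; `B16Ineq147Count261.ineq147_of_ineq190_cubeSites`).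
Mega-formalization `lit-balaban`, HOME `run/shared/lean/pub/lit-balaban/`; Phase-2 proof seat p29 gen 11 (unit `lit-balaban-p29`,
free-target protocol G.5-34(d): item (ii) of the p29 gen-10 HANDOFF menu).  KNITTING — used BY NAME, nothing restated: p29 g8
`B15Ineq147LevelGap.{toR, cube, corner, corner_mem_cube, corner_mem_layer, CubeSite, zoneC, posC, scaleC, LayerSepZd}`
(p299858), `B15Ineq147Admissible.{Touching, bondN, dist_posC_le_of_touching, zone_le_succ_of_touching, adj_nbr_of_touching}`
(p301778), r11 `B14DomainGeom.{cubeIdx, cubeIdx_le, lt_cubeIdx, cubeIdx_eq_of_mem, IsUnionOfCubes}`, pv08/r03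
`B6Geometry.{LevelGap, Separates, ContourSystem, Realizes}`, p29 g10 `B6Ineq261LevelGap.{K261, levelGap_of_le, rowSum_cubeSites,
lemma21_cubeSites}`, r08 `B11SectG.RowSum`, r03 `B6Lemma21Repaired.Ineq26xWith`, pv08 `B6RandomWalk.Ineq260`.

THE PRINTED TEXT.  [B6] p. 224 [PDF 2]: *«Ω₁ ⊃ Ω₂ ⊃ … ⊃ Ω_k, Ω_j ⊂ T_η, (2.1) … Ω_j = B^j(Ω_j^{(j)}), Ω_j^{(j)} ⊂ T^{(j)}_η and it
is a sum of big blocks, (L^jη)^{−1}dist(Ω^c_j, Ω_{j+1}) > RM, M is a size of big blocks (2.2) … Ω₁ = ⋃_{j=1}^k B^j(Λ_j),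
T = ⋃_{j=0}^k B^j(Λ_j), where B⁰(Λ₀) = Λ₀. (2.4)»*; p. 231 [PDF 9]: *«We consider a special class of contours Γ. They have the
property that a part of Γ contained in B^j(Λ_j) consists of bonds of the lattice Λ_j. Now we define d(y, y′) = inf_Γ Σ_j
(L^jη)^{−1}|Γ_{y,y′} ∩ B^j(Λ_j)| (2.46)»*; p. 233 [PDF 11]: *«(L^{j_{l,l+1}}η)^{−1}|y′_l − y_{l+1}| > RM (2.57)»*; p. 234 [PDF 12]
Lemma 2.1 (2.60)–(2.63).  [IV] p. 179 [PDF 5]: *«complete these two sets to a sequence Z″_k, Z″_{k−1}, …, Z″_{k−N₀+1} in such a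
way that the complements of these sets form an admissible sequence of domains based on partitions into M-cubes in the
corresponding scales. Thus Z″_k, Z″_k∖Z″_{k−1} are unions of M-cubes of the lattice T_η, and Z″_k, Z″_{k−1} are separated by one
layer of M-cubes. Similarly, Z″_{k−1}, Z″_{k−1}∖Z″_{k−2} are unions of L^{−1}M-cubes of this lattice, and Z″_{k−1}, Z″_{k−2} are
separated by one layer of L^{−1}M-cubes, and so on.»*; p. 186 [PDF 12]: the scaled distance *«defined in terms of M₁-cubes on
corresponding scales»*.

THE MODEL (dictionary = `B15Ineq147LevelGap` §4: finest lattice `ℤᵈ`, η = 1, scales counted from the bottom, the layer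
`Z″_{n+1}∖Z″_n` made of `M₁Lⁿ`-cubes = the cube-sites of scale `n`).  Print's admissible contours are chains of lattice bonds
passing from one cube of the generating set to a neighbouring one; this file reads them as chains of TOUCHING cubes (two
cube-sites `s`, `t` touch when some lattice point of one is within sup-distance `1` of some lattice point of the other,
`B15Ineq147Admissible.Touching` — corner contacts included, so the resulting contour distance is the smaller, i.e. the
conservative one for (2.61)) and defines the bond graph `touchC := SimpleGraph.fromRel Touching`.

WHAT THIS FILE PROVES (kernel-checked, zero `sorry`; two definitions with bodies (`touchC`, `Tiles`) and one `B6.Geometry`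
model (`touchGeo`), theorems otherwise; no named fact; axioms standard).
§1 `touchC`, `touching_symm`, `touchC_adj`, **`touchC_adj_dist`** (touching cubes have corners within the COARSER side —
   exactly the `hadj` input of `B6Ineq261LevelGap.rowSum_cubeSites`), `touchC_le_bondN` (under the one-layer separation every
   bond of `touchC` is a bond of the neighbour-scale model `bondN`, so `B15Ineq147Admissible` §4's walk bounds apply to its
   walks), `separates_touchC` (touching cubes lie on equal or consecutive scales).
§2 **`levelGap_touchC_sharp`**, **`levelGap_touchC`** — THE WALK FORM OF (2.2)/(2.57): from `Monotone Z″` and the one-layer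
   separation `LayerSepZd Z″ M L` alone (`M₁ ≥ 1`, `L ≥ 1`), every chain of touching cubes from a cube of scale `< i` to a cube
   of scale `> i` has at least `L·(M/M₁)` bonds (`LevelGap touchC zoneC (L·(M/M₁) − 1)`), hence `LevelGap touchC zoneC (M/M₁)`
   for `L ≥ 2`.  MECHANISM (a point-chain displacement argument, private `exists_chain_point`): along a chain of `q` touching
   cubes of scale `≤ i` a lattice point is displaced by at most `q·M₁Lⁱ` (inside one cube `≤ M₁Lⁱ − 1`, across a contact `≤ 1`),
   while the corner of the first cube lies in `Z″_i` and every point of the last cube outside `Z″_{i+1}`, at sup-distance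
   `≥ M·L^{i+1}` by the separating layer.  (The corner/`BondScale` route of `B15Ineq147LevelGap.levelGap_cube` and
   `B15Ineq147Admissible.directGap_nbr` gives only `DirectGap` for bonds measured between corners within the coarser side; the
   point chain recovers the STRICT walk form for genuinely touching cubes.)
§3 `Tiles` (every lattice point lies in the cube of some cube-site — the partition (2.4) «T = ⋃_j B^j(Λ_j)» for the model),
   `mem_cube_iff_cubeIdx`, **`tiles_of_layers`** (layers `Z″_{n+1}∖Z″_n` that are unions of `M₁Lⁿ`-cubes and cover `ℤᵈ` ⇒
   `Tiles`), `cover_of_exhaustive` (`Z″_0 = ∅`, `⋃_n Z″_n = ℤᵈ` ⇒ the layers cover), `layers_of_partitions` (layers that are unions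
   of the coarser `M·Lⁿ`-cubes, `M₁ ∣ M` — print's «partitions into M-cubes in the corresponding scales» — are unions of
   `M₁Lⁿ`-cubes), `touchC_reachable_of_points`, **`touchC_connected`** (`Tiles` ⇒ `(touchC M₁ L Z).Connected`: neighbouring
   lattice points lie in equal or touching cubes, and `ℤᵈ` is connected by unit steps).
§4 THE INSTANCES: **`rowSum_touchC`** ((2.61) `RowSum g σ (K261 N d L 1 σ)`) and **`lemma21_touchC`** (Lemma 2.1, all four
   displays) for EVERY geometry `g` realised by the touching-cube contours (`ι : g.Site ↪ CubeSite M₁ L Z` with zones,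
   `g.dist = touchC.dist`), from `Monotone Z″`, `LayerSepZd Z″ M L`, `Tiles`, `M₁ ≥ 1`, `L ≥ 1`, any `N ≥ 1` with
   `N + 1 ≤ L·(M/M₁)` and the (2.59)-shape condition `e^{−σ}L^{2d/N} < 1` — `B6Ineq261LevelGap.rowSum_cubeSites` /
   `lemma21_cubeSites` with `hconn`, `hgap`, `hadj` DISCHARGED by §§1–3; `rowSum_touchC_div` / `lemma21_touchC_div` the
   `N = M/M₁` forms (`L ≥ 2`, `M₁ ≤ M`).
§5 `touchGeo` — the `B6.Geometry` whose sites ARE a finite set `F` of cube-sites (scale = zone, distance = the touching-contour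
   distance; the localisation vocabulary trivial as in `B6CoverBox.boxGeo`), `realizes_touchGeo`, **`rowSum_touchGeo`**,
   **`lemma21_touchGeo`**: Lemma 2.1 for it with NO geometric hypothesis beyond `Monotone Z″`, `LayerSepZd`, `Tiles` (and the
   numerics) — the named inhabited instance.
§6 (v1.1, append-only) `walk_length_ge_touchC_Z`, **`ineq147_walk_touchC`** ((1.47) p. 186 [IV] in r12's typed shape
   `B15.PrelimIntegrations.Ineq147 δ |Γ| M M₁ (j − i)` for every chain Γ of touching cubes from scale `≤ i` to a cube not inside
   `Z″_{j+1}`), **`dist_ge_touchC_Z`** (the distance form under `Tiles`), `walk_length_ge_touchC_admissible` (every [III]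
   (2.13)-admissible sequence; the touching-cube sibling of `B15Ineq147Admissible.walk_length_ge_nbr_admissible`).
HONEST SCOPE.  (i) The contour reading (touching cubes, sup-metric contacts) is this file's model of p. 231's admissible contours
on the [IV] cube carrier, declared, not derived from print; it yields a distance no larger than any reading with fewer
admissible bonds, so (2.61) proved here is the conservative case.  (ii) Carrier `ℤᵈ` (universal cover), not the torus `T_η`;
`Z″` is any nested family with the two printed properties (cube unions, one separating layer) plus the covering (2.4); [III]
(2.13)-admissible sequences supply `Monotone`/`LayerSepZd` by `B15Ineq147Admissible.{monotone_compl_of_admissible,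
layerSepZd_of_admissible}`.  (iii) The (2.61) constant is `B6Ineq261LevelGap`'s `L`-dependent `K261` (its honest scope (i)).
NOT summit progress.
-/

namespace Literature.MathematicalPhysics.QuantumFieldTheory.Balaban1983to89.B15TouchingCubeContours

open Literature.MathematicalPhysics.QuantumFieldTheory.Balaban1983to89
open B6Geometry B6LevelGapMetric B15Ineq147LevelGap B15Ineq147Admissible B14DomainGeom B6Ineq261LevelGap B11SectG

variable {d : ℕ} {M₁ L : ℕ} {Z : ℕ → Set (Fin d → ℤ)}

/-! ## §1. The graph of touching cubes -/

/-- **The bond graph of touching cubes**: two distinct cube-sites of the ℤᵈ model are joined when their lattice cubes touch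
(`Touching`: some lattice point of one within sup-distance `1` of some lattice point of the other) — the model's admissible
bonds, a contour *«consisting of bonds of the lattice»* of *«M₁-cubes on corresponding scales»* being a chain of such contacts.
[cite: Balaban1984PropagatorsII, (2.46) p.231; Balaban1989LargeFieldI, p.186] -/
def touchC (M₁ L : ℕ) (Z : ℕ → Set (Fin d → ℤ)) : SimpleGraph (CubeSite M₁ L Z) :=
  SimpleGraph.fromRel Touching

/-- Touching is symmetric. [cite: Balaban1984PropagatorsII, (2.46) p.231] -/
theorem touching_symm {s t : CubeSite M₁ L Z} (h : Touching s t) : Touching t s := by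
  obtain ⟨p, hp, q, hq, hpq⟩ := h
  exact ⟨q, hq, p, hp, by rwa [dist_comm]⟩

/-- Unfolding of the adjacency of `touchC`. [cite: Balaban1984PropagatorsII, (2.46) p.231] -/
theorem touchC_adj {s t : CubeSite M₁ L Z} : (touchC M₁ L Z).Adj s t ↔ s ≠ t ∧ Touching s t := by
  rw [touchC, SimpleGraph.fromRel_adj]
  exact ⟨fun ⟨hne, h⟩ => ⟨hne, h.elim id touching_symm⟩, fun ⟨hne, h⟩ => ⟨hne, Or.inl h⟩⟩

/-- **Touching cubes have corners within the coarser side** `M₁·L^{max(scale s, scale t)}` (`L ≥ 1`) — the hypothesis `hadj`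
of `B6Ineq261LevelGap.rowSum_cubeSites` / `lemma21_cubeSites` for `G = touchC`. [cite: Balaban1984PropagatorsII, (2.46) p.231; Balaban1989LargeFieldI, p.186] -/
theorem touchC_adj_dist (hL : 1 ≤ L) ⦃s t : CubeSite M₁ L Z⦄ (h : (touchC M₁ L Z).Adj s t) :
    dist (posC s) (posC t) ≤ scaleC M₁ L (max (zoneC s) (zoneC t)) :=
  dist_posC_le_of_touching hL (touchC_adj.mp h).2

/-- Under the one-layer separation (`M ≥ 1`, `L ≥ 2`) every bond of `touchC` is a bond of the neighbour-scale model `bondN`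
(`B15Ineq147Admissible.adj_nbr_of_touching`): walks of touching cubes map into `bondN` (`SimpleGraph.Walk.mapLe`).
[cite: Balaban1989LargeFieldI, p.179, (1.47) p.186] -/
theorem touchC_le_bondN {M : ℕ} (hmono : Monotone Z) (hsep : LayerSepZd Z M L) (hM : 1 ≤ M) (hL : 2 ≤ L) :
    touchC M₁ L Z ≤ bondN M₁ L Z := fun _ _ h =>
  adj_nbr_of_touching hmono hsep hM hL (touchC_adj.mp h).1 (touchC_adj.mp h).2

/-- Under the one-layer separation touching cubes lie on equal or consecutive scales (*«The surface Σ_j separates the sets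
B^j(Λ_j) and B^{j−1}(Λ_{j−1})»*): `Separates touchC zoneC`. [cite: Balaban1984PropagatorsII, p.231; Balaban1989LargeFieldI, p.179] -/
theorem separates_touchC {M : ℕ} (hmono : Monotone Z) (hsep : LayerSepZd Z M L) (hM : 1 ≤ M) (hL : 2 ≤ L) :
    Separates (touchC M₁ L Z) zoneC := fun _ _ h =>
  ⟨zone_le_succ_of_touching hmono hsep hM hL (touchC_adj.mp h).2,
    zone_le_succ_of_touching hmono hsep hM hL (touching_symm (touchC_adj.mp h).2)⟩

/-! ## §2. The walk form of (2.2)/(2.57) for touching cubes, by point chains -/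

/-- Two lattice points of one cube of side `s ≥ 1` are at sup-distance `≤ s − 1`. [folklore] -/
private theorem dist_toR_le_of_mem_cube {n : ℕ} {c p q : Fin d → ℤ} (hp : p ∈ cube M₁ L n c)
    (hq : q ∈ cube M₁ L n c) (hs : 0 < M₁ * L ^ n) :
    dist (toR p) (toR q) ≤ ((M₁ * L ^ n : ℕ) : ℝ) - 1 := by
  have hs1 : (1 : ℝ) ≤ ((M₁ * L ^ n : ℕ) : ℝ) := by exact_mod_cast hs
  refine (dist_pi_le_iff (by linarith)).mpr fun μ => ?_
  rw [Real.dist_eq]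
  show |((p μ : ℤ) : ℝ) - ((q μ : ℤ) : ℝ)| ≤ _
  have h1 := hp μ
  have h2 := hq μ
  have hz : |p μ - q μ| ≤ ((M₁ * L ^ n : ℕ) : ℤ) - 1 := by
    rw [abs_le]
    constructor <;> nlinarith [h1.1, h1.2, h2.1, h2.2]
  exact_mod_cast hz

/-- Point chains along touching cubes: if every bond of a walk STARTS in a cube of scale `≤ i`, a lattice point of the first
cube is within sup-distance `(number of bonds)·M₁Lⁱ` of some lattice point of the last cube (`L ≥ 1`). [folklore] -/
private theorem exists_chain_point (hM₁ : 0 < M₁) (hL : 1 ≤ L) (i : ℕ) :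
    ∀ {s t : CubeSite M₁ L Z} (p : (touchC M₁ L Z).Walk s t), (∀ e ∈ p.darts, zoneC e.fst ≤ i) →
      ∀ a ∈ cube M₁ L s.1.1 s.1.2, ∃ b ∈ cube M₁ L t.1.1 t.1.2,
        dist (toR a) (toR b) ≤ (p.length : ℝ) * ((M₁ * L ^ i : ℕ) : ℝ) := by
  intro s t p
  induction p with
  | nil => intro _ a ha; exact ⟨a, ha, by simp⟩
  | @cons u v w h q ih =>
    intro hd a ha
    have hu : zoneC u ≤ i := hd ⟨(u, v), h⟩ (by simp [SimpleGraph.Walk.darts_cons])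
    obtain ⟨x, hx, y, hy, hxy⟩ := (touchC_adj.mp h).2
    have hside : ((M₁ * L ^ u.1.1 : ℕ) : ℝ) ≤ ((M₁ * L ^ i : ℕ) : ℝ) := by
      exact_mod_cast Nat.mul_le_mul_left M₁ (pow_le_pow_right₀ hL hu)
    have hax : dist (toR a) (toR x) ≤ ((M₁ * L ^ i : ℕ) : ℝ) - 1 :=
      (dist_toR_le_of_mem_cube ha hx (Nat.mul_pos hM₁ (Nat.pow_pos (by omega)))).trans (by linarith)
    obtain ⟨b, hb, hyb⟩ :=
      ih (fun e he => hd e (by rw [SimpleGraph.Walk.darts_cons]; exact List.mem_cons_of_mem _ he)) y hy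
    refine ⟨b, hb, ?_⟩
    calc dist (toR a) (toR b) ≤ dist (toR a) (toR x) + dist (toR x) (toR y) + dist (toR y) (toR b) :=
          dist_triangle4 _ _ _ _
      _ ≤ (((M₁ * L ^ i : ℕ) : ℝ) - 1) + 1 + (q.length : ℝ) * ((M₁ * L ^ i : ℕ) : ℝ) := by linarith
      _ = ((SimpleGraph.Walk.cons h q).length : ℝ) * ((M₁ * L ^ i : ℕ) : ℝ) := by
          rw [SimpleGraph.Walk.length_cons]; push_cast; ring

/-- First crossing with the scales of the STARTING points recorded: a walk from zone `≤ i` to zone `> i` has an initial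
segment ending in zone `> i`, every bond of which starts in zone `≤ i`. [folklore] -/
private theorem exists_prefix_fst {V : Type*} {G : SimpleGraph V} (zone : V → ℕ) (i : ℕ) :
    ∀ {v x : V} (p : G.Walk v x), zone v ≤ i → i < zone x →
      ∃ (b : V) (q : G.Walk v b), i < zone b ∧ q.length ≤ p.length ∧ ∀ e ∈ q.darts, zone e.fst ≤ i := by
  intro v x p
  induction p with
  | nil => intro hv hx; omega
  | @cons a b c h p ih =>
    intro ha hc
    by_cases hb : i < zone b
    · refine ⟨b, SimpleGraph.Walk.cons h SimpleGraph.Walk.nil, hb, ?_, ?_⟩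
      · simp only [SimpleGraph.Walk.length_cons, SimpleGraph.Walk.length_nil]; omega
      · intro e he
        rw [SimpleGraph.Walk.darts_cons, SimpleGraph.Walk.darts_nil, List.mem_singleton] at he
        subst he
        exact ha
    · obtain ⟨b', q, hb', hq, hd⟩ := ih (not_lt.mp hb) hc
      refine ⟨b', SimpleGraph.Walk.cons h q, hb', ?_, ?_⟩
      · simp only [SimpleGraph.Walk.length_cons]; omega
      · intro e he
        rw [SimpleGraph.Walk.darts_cons, List.mem_cons] at he
        rcases he with rfl | he
        · exact ha
        · exact hd e he

/-- **The walk form of (2.2)/(2.57) for touching cubes, sharp form.**  For nested `Z″_n ⊂ ℤᵈ` with one layer of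
`M·L^{n+1}`-cubes between `Z″_n` and `(Z″_{n+1})^c` (`LayerSepZd Z″ M L`), `M₁ ≥ 1`, `L ≥ 1`: every chain of touching cubes from
a cube of scale `< i` to a cube of scale `> i` has at least `L·(M/M₁)` bonds — `LevelGap touchC zoneC (L·(M/M₁) − 1)` (*«more
than RM bonds of the lattice Λ_{j_{l,l+1}}»* of (2.57), with print's RM realised by the layer width counted in cubes).  By the
point chain: the corner of the first cube lies in `Z″_i`, every point of the first cube of scale `> i` outside `Z″_{i+1}`, and
`q` touching cubes of scale `≤ i` displace a point by at most `q·M₁Lⁱ`.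
[cite: Balaban1984PropagatorsII, (2.2) p.224, (2.57) p.233; Balaban1989LargeFieldI, p.179, (1.47) p.186] -/
theorem levelGap_touchC_sharp {M : ℕ} (hmono : Monotone Z) (hsep : LayerSepZd Z M L) (hM₁ : 0 < M₁) (hL : 1 ≤ L) :
    LevelGap (touchC M₁ L Z) zoneC (L * (M / M₁) - 1) := by
  intro i u x hu hx p
  obtain ⟨b, q, hb, hqp, hfst⟩ := exists_prefix_fst zoneC i p hu.le hx
  have hs : ∀ n, 0 < M₁ * L ^ n := fun n => Nat.mul_pos hM₁ (Nat.pow_pos (by omega))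
  obtain ⟨β, hβ, hchain⟩ :=
    exists_chain_point hM₁ hL i q hfst (corner M₁ L u.1.1 u.1.2) (corner_mem_cube (hs _) _)
  -- the corner of `u` lies in `Z″_i`, the point `β` of the cube `b` outside `Z″_{i+1}`
  have ha : corner M₁ L u.1.1 u.1.2 ∈ Z i :=
    hmono (show u.1.1 + 1 ≤ i from hu) (corner_mem_layer hM₁ (by omega) u).1
  have hβ' : β ∉ Z (i + 1) := fun hmem => (b.2 hβ).2 (hmono (show i + 1 ≤ b.1.1 from hb) hmem)
  have hlay : (M : ℝ) * (L : ℝ) ^ (i + 1) ≤ dist (toR (corner M₁ L u.1.1 u.1.2)) (toR β) := hsep ha hβ'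
  -- `L·(M/M₁)·M₁Lⁱ ≤ M·L^{i+1} ≤ q.length·M₁Lⁱ`
  have hdiv : M / M₁ * M₁ ≤ M := Nat.div_mul_le_self M M₁
  have key : L * (M / M₁) ≤ q.length := by
    have h1 : ((L * (M / M₁) : ℕ) : ℝ) * ((M₁ * L ^ i : ℕ) : ℝ) ≤ (q.length : ℝ) * ((M₁ * L ^ i : ℕ) : ℝ) :=
      calc ((L * (M / M₁) : ℕ) : ℝ) * ((M₁ * L ^ i : ℕ) : ℝ)
          = ((M / M₁ * M₁ : ℕ) : ℝ) * (L : ℝ) ^ (i + 1) := by push_cast; ring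
        _ ≤ (M : ℝ) * (L : ℝ) ^ (i + 1) :=
            mul_le_mul_of_nonneg_right (by exact_mod_cast hdiv) (by positivity)
        _ ≤ (q.length : ℝ) * ((M₁ * L ^ i : ℕ) : ℝ) := hlay.trans hchain
    have hpos : (0 : ℝ) < ((M₁ * L ^ i : ℕ) : ℝ) := by exact_mod_cast hs i
    exact_mod_cast le_of_mul_le_mul_right h1 hpos
  have hne : u ≠ b := by
    rintro rfl
    exact absurd (hu.trans hb) (lt_irrefl _)
  have h1 : 1 ≤ q.length := by
    rcases Nat.eq_zero_or_pos q.length with h0 | h0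
    · exact absurd (SimpleGraph.Walk.eq_of_length_eq_zero h0) hne
    · exact h0
  generalize L * (M / M₁) = K at key
  omega

/-- **The walk form of (2.2)/(2.57) for touching cubes**: `LevelGap touchC zoneC (M/M₁)` — every chain of touching cubes from
scale `< i` to scale `> i` has more than `M/M₁` bonds — from `Monotone Z″`, the one-layer separation, `M₁ ≥ 1`, `L ≥ 2` (no
divisibility needed); the hypothesis `hgap` of `B6Ineq261LevelGap.rowSum_cubeSites` / `lemma21_cubeSites` and of
`B16Ineq147Count261.ineq147_of_ineq190_cubeSites` for `G = touchC`. [cite: Balaban1984PropagatorsII, (2.2) p.224, (2.57) p.233; Balaban1989LargeFieldI, p.179, (1.47) p.186] -/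
theorem levelGap_touchC {M : ℕ} (hmono : Monotone Z) (hsep : LayerSepZd Z M L) (hM₁ : 0 < M₁) (hL : 2 ≤ L) :
    LevelGap (touchC M₁ L Z) zoneC (M / M₁) := by
  refine levelGap_of_le (levelGap_touchC_sharp hmono hsep hM₁ (by omega)) ?_
  have h2 : 2 * (M / M₁) ≤ L * (M / M₁) := Nat.mul_le_mul_right _ hL
  generalize M / M₁ = n at h2 ⊢
  generalize L * n = K at h2
  omega

/-- The (1.47)-type walk bound for touching cubes (the sibling files' shape): a chain of touching cubes from a cube of scale
`≤ i` to a cube of scale `≥ j + 1` has at least `(M/M₁)(j − i)` bonds; with the sharp gap even `(L·(M/M₁) − 1)(j − i)`.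
[cite: Balaban1989LargeFieldI, (1.47) p.186; Balaban1984PropagatorsII, (2.60) p.234] -/
theorem walk_length_ge_touchC {M : ℕ} (hmono : Monotone Z) (hsep : LayerSepZd Z M L) (hM₁ : 0 < M₁) (hL : 2 ≤ L)
    {i j : ℕ} {s t : CubeSite M₁ L Z} (p : (touchC M₁ L Z).Walk s t) (hs : zoneC s ≤ i) (ht : j + 1 ≤ zoneC t) :
    M / M₁ * (j - i) ≤ p.length :=
  length_ge_mul_of_levelGap (levelGap_touchC hmono hsep hM₁ hL) p hs ht

/-! ## §3. The partition (2.4) «T = ⋃_j B^j(Λ_j)» for the model, and connectedness -/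

/-- **The covering property of the model** ((2.4) «T = ⋃_{j=0}^k B^j(Λ_j)»: the blocks of the generating set partition the
whole lattice): every lattice point of `ℤᵈ` lies in the cube of some cube-site. [cite: Balaban1984PropagatorsII, (2.4) p.224; Balaban1989LargeFieldI, p.179] -/
def Tiles (M₁ L : ℕ) (Z : ℕ → Set (Fin d → ℤ)) : Prop :=
  ∀ x : Fin d → ℤ, ∃ s : CubeSite M₁ L Z, x ∈ cube M₁ L s.1.1 s.1.2

/-- A lattice point lies in the scale-`n` cube of index `c` iff its scale-`n` cube index (`B14DomainGeom.cubeIdx`, coordinatewise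
floor division by the side `M₁Lⁿ ≥ 1`) is `c`. [cite: Balaban1989LargeFieldI, condition (i) p.177, p.186] -/
theorem mem_cube_iff_cubeIdx {n : ℕ} (hs : 0 < M₁ * L ^ n) {c y : Fin d → ℤ} :
    y ∈ cube M₁ L n c ↔ cubeIdx (M₁ * L ^ n) y = c := by
  constructor
  · intro hy
    exact cubeIdx_eq_of_mem _ hs y c fun μ => ⟨(hy μ).1, by linarith [(hy μ).2]⟩
  · rintro rfl μ
    exact ⟨cubeIdx_le _ hs y μ, by linarith [lt_cubeIdx _ hs y μ]⟩

/-- **The covering from the printed shape of the layers**: if every layer `Z″_{n+1}∖Z″_n` is a union of `M₁Lⁿ`-cubes of the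
scale-`n` partition (*«unions of M-cubes of the lattice … L^{−1}M-cubes … and so on»*, `M₁ ∣ M`) and the layers cover `ℤᵈ`,
then every lattice point lies in the cube of a cube-site (`M₁ ≥ 1`, `L ≥ 1`). [cite: Balaban1989LargeFieldI, p.179; Balaban1984PropagatorsII, (2.4) p.224] -/
theorem tiles_of_layers (hM₁ : 0 < M₁) (hL : 0 < L)
    (hlayer : ∀ n, IsUnionOfCubes (M₁ * L ^ n) (Z (n + 1) \ Z n))
    (hcover : ∀ x, ∃ n, x ∈ Z (n + 1) \ Z n) : Tiles M₁ L Z := by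
  intro x
  obtain ⟨n, hx⟩ := hcover x
  have hs : 0 < M₁ * L ^ n := Nat.mul_pos hM₁ (Nat.pow_pos hL)
  refine ⟨⟨(n, cubeIdx (M₁ * L ^ n) x), fun y hy => ?_⟩, (mem_cube_iff_cubeIdx hs).mpr rfl⟩
  exact (hlayer n y x ((mem_cube_iff_cubeIdx hs).mp hy)).mpr hx

/-- The layers cover `ℤᵈ` when `Z″_0 = ∅` and the `Z″_n` exhaust the lattice (*«we admit the case when some domains Ω_j are equal
to T_η»*: the last complement is everything): each point lies in `Z″_{n+1}∖Z″_n` for the least `n + 1` with `x ∈ Z″_{n+1}`.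
[cite: Balaban1984PropagatorsII, (2.1)–(2.4) p.224; Balaban1989LargeFieldI, p.179] -/
theorem cover_of_exhaustive (h0 : Z 0 = ∅) (hex : ∀ x, ∃ n, x ∈ Z n) :
    ∀ x : Fin d → ℤ, ∃ n, x ∈ Z (n + 1) \ Z n := by
  classical
  intro x
  have hn : x ∈ Z (Nat.find (hex x)) := Nat.find_spec (hex x)
  have hpos : Nat.find (hex x) ≠ 0 := fun h => by
    rw [h, h0] at hn
    exact hn
  obtain ⟨m, hm⟩ : ∃ m, Nat.find (hex x) = m + 1 := ⟨Nat.find (hex x) - 1, by omega⟩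
  refine ⟨m, by rw [← hm]; exact hn, fun hxm => ?_⟩
  exact Nat.find_min (hex x) (show m < Nat.find (hex x) by omega) hxm

/-- A union of `s·t`-cubes is a union of `s`-cubes (nested partitions). [folklore] -/
private theorem isUnionOfCubes_of_mul {s t : ℕ} {Λ : Set (Fin d → ℤ)} (h : IsUnionOfCubes (s * t) Λ) :
    IsUnionOfCubes s Λ := by
  intro x y hxy
  apply h
  funext i
  have hi := congrFun hxy i
  unfold cubeIdx at hi ⊢
  push_cast
  rw [← Int.ediv_ediv_of_nonneg (Int.natCast_nonneg s), ← Int.ediv_ediv_of_nonneg (Int.natCast_nonneg s), hi]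

/-- Print's carrier: layers that are unions of the PARTITION cubes of side `M·Lⁿ` (*«based on partitions into M-cubes in the
corresponding scales»*) are unions of the bond cubes of side `M₁Lⁿ` whenever `M₁ ∣ M`. [cite: Balaban1989LargeFieldI, p.179, p.186] -/
theorem layers_of_partitions {M : ℕ} (hdvd : M₁ ∣ M)
    (hZ : ∀ n, IsUnionOfCubes (M * L ^ n) (Z (n + 1) \ Z n)) :
    ∀ n, IsUnionOfCubes (M₁ * L ^ n) (Z (n + 1) \ Z n) := by
  intro n
  obtain ⟨t, rfl⟩ := hdvd
  have h : IsUnionOfCubes (M₁ * L ^ n * t) (Z (n + 1) \ Z n) := by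
    have e : M₁ * t * L ^ n = M₁ * L ^ n * t := by ring
    rw [← e]
    exact hZ n
  exact isUnionOfCubes_of_mul h

/-- Lattice points at sup-distance `≤ 1` lie in equal or touching cubes: their cube-sites are joined in `touchC`.
[cite: Balaban1984PropagatorsII, (2.46) p.231] -/
theorem touchC_reachable_of_points {s t : CubeSite M₁ L Z} {x y : Fin d → ℤ} (hx : x ∈ cube M₁ L s.1.1 s.1.2)
    (hy : y ∈ cube M₁ L t.1.1 t.1.2) (hxy : dist (toR x) (toR y) ≤ 1) : (touchC M₁ L Z).Reachable s t := by
  by_cases hst : s = t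
  · subst hst
    rfl
  · exact SimpleGraph.Adj.reachable (touchC_adj.mpr ⟨hst, x, hx, y, hy, hxy⟩)

/-- One unit step in one coordinate moves a lattice point by sup-distance `≤ 1`. [folklore] -/
private theorem dist_toR_update_le_one (x : Fin d → ℤ) (μ : Fin d) (v : ℤ) :
    dist (toR (Function.update x μ v)) (toR (Function.update x μ (v + 1))) ≤ 1 := by
  refine (dist_pi_le_iff zero_le_one).mpr fun ν => ?_
  rw [Real.dist_eq]
  unfold toR
  by_cases hν : ν = μ
  · subst hν
    simp
  · simp [Function.update_of_ne hν]

section Chosen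

variable (σ : (Fin d → ℤ) → CubeSite M₁ L Z) (hσ : ∀ x, x ∈ cube M₁ L (σ x).1.1 (σ x).1.2)
include hσ

/-- Moving one coordinate up by `m` unit steps keeps the chosen cube-sites in one component. [folklore] -/
private theorem reachable_update_add (x : Fin d → ℤ) (μ : Fin d) (v : ℤ) :
    ∀ m : ℕ, (touchC M₁ L Z).Reachable (σ (Function.update x μ v)) (σ (Function.update x μ (v + m)))
  | 0 => by simp
  | m + 1 => by
    refine (reachable_update_add x μ v m).trans (touchC_reachable_of_points (hσ _) (hσ _) ?_)
    have e : v + ((m + 1 : ℕ) : ℤ) = (v + m) + 1 := by push_cast; ring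
    rw [e]
    exact dist_toR_update_le_one x μ (v + m)

/-- Changing one coordinate arbitrarily keeps the chosen cube-sites in one component. [folklore] -/
private theorem reachable_update (x : Fin d → ℤ) (μ : Fin d) (w : ℤ) :
    (touchC M₁ L Z).Reachable (σ x) (σ (Function.update x μ w)) := by
  rcases le_total (x μ) w with h | h
  · obtain ⟨m, hm⟩ := Int.le.dest h
    have := reachable_update_add σ hσ x μ (x μ) m
    rwa [Function.update_eq_self, hm] at this
  · obtain ⟨m, hm⟩ := Int.le.dest h
    have := reachable_update_add σ hσ x μ w m
    rw [hm, Function.update_eq_self] at this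
    exact this.symm

/-- Any two lattice points have chosen cube-sites in one component (`ℤᵈ` is connected by unit steps). [folklore] -/
private theorem reachable_chosen (x y : Fin d → ℤ) : (touchC M₁ L Z).Reachable (σ x) (σ y) := by
  classical
  suffices H : ∀ (S : Finset (Fin d)) (x y : Fin d → ℤ), (∀ ν, ν ∉ S → x ν = y ν) →
      (touchC M₁ L Z).Reachable (σ x) (σ y) from
    H Finset.univ x y (fun ν hν => absurd (Finset.mem_univ ν) hν)
  intro S
  induction S using Finset.induction_on with
  | empty =>
    intro x y h
    rw [show x = y from funext fun ν => h ν (Finset.notMem_empty ν)]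
  | @insert μ S _ ih =>
    intro x y h
    refine (reachable_update σ hσ x μ (y μ)).trans (ih _ y fun ν hν => ?_)
    by_cases hνμ : ν = μ
    · subst hνμ
      simp
    · rw [Function.update_of_ne hνμ]
      exact h ν (by simp [hνμ, hν])

end Chosen

/-- **The touching-cube graph is connected** when the cubes of the cube-sites cover `ℤᵈ` (`Tiles`; `M₁ ≥ 1`, `L ≥ 1`): admissible
contours exist between any two blocks of the generating set, so (2.46) is a genuine minimum — the hypothesis `hconn` of
`B6Ineq261LevelGap.rowSum_cubeSites` / `lemma21_cubeSites` and of the (1.47) knit `B16Ineq147Count261.ineq147_of_ineq190_cubeSites`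
for `G = touchC`. [cite: Balaban1984PropagatorsII, (2.4) p.224, (2.46) p.231] -/
theorem touchC_connected (ht : Tiles M₁ L Z) (hM₁ : 0 < M₁) (hL : 0 < L) : (touchC M₁ L Z).Connected := by
  choose σ hσ using ht
  haveI : Nonempty (CubeSite M₁ L Z) := ⟨σ fun _ => 0⟩
  have hs : ∀ u : CubeSite M₁ L Z, (touchC M₁ L Z).Reachable u (σ (corner M₁ L u.1.1 u.1.2)) := fun u =>
    touchC_reachable_of_points (corner_mem_cube (Nat.mul_pos hM₁ (Nat.pow_pos hL)) _) (hσ _) (by simp)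
  exact ⟨fun s t => ((hs s).trans (reachable_chosen σ hσ _ _)).trans (hs t).symm⟩

/-! ## §4. (2.61) and Lemma 2.1 for every geometry realised by touching-cube contours -/

section Instances

variable {g : B6.Geometry} {M N : ℕ}

/-- **(2.61) for every geometry realised by the touching-cube contours** of a nested family `Z″_n ⊂ ℤᵈ` with the one-layer
separation and the covering (2.4): `RowSum g σ (K261 N d L 1 σ)` for any `N ≥ 1` with `N + 1 ≤ L·(M/M₁)` under
`e^{−σ}·L^{2d/N} < 1` — `B6Ineq261LevelGap.rowSum_cubeSites` with `hconn` (`touchC_connected`), `hgap` (`levelGap_touchC_sharp`)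
and `hadj` (`touchC_adj_dist`) DISCHARGED; left: the embedding `ι` of `𝔅` into the cube-sites with its zones, `g.dist` = the
touching-contour distance, `Monotone Z″`, `LayerSepZd Z″ M L`, `Tiles`, `M₁ ≥ 1`, `L ≥ 1`.
[cite: Balaban1984PropagatorsII, Lemma 2.1 (2.61) p.234, (2.2)–(2.4) p.224; Balaban1989LargeFieldI, p.179, p.186] -/
theorem rowSum_touchC {σ : ℝ} (ι : g.Site → CubeSite M₁ L Z) (hι : Function.Injective ι)
    (hzone : ∀ y, zoneC (ι y) = g.scale y) (hdist : ∀ y y', g.dist y y' = ((touchC M₁ L Z).dist (ι y) (ι y') : ℝ))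
    (hmono : Monotone Z) (hsep : LayerSepZd Z M L) (ht : Tiles M₁ L Z) (hM₁ : 0 < M₁) (hL : 1 ≤ L)
    (hN : 0 < N) (hNgap : N + 1 ≤ L * (M / M₁))
    (hθ : Real.exp (-σ) * (L : ℝ) ^ ((2 * d : ℝ) / N) < 1) :
    RowSum g σ (K261 N d L 1 σ) :=
  rowSum_cubeSites (touchC M₁ L Z) ι hι hzone hdist (touchC_connected ht hM₁ (by omega))
    (levelGap_of_le (levelGap_touchC_sharp hmono hsep hM₁ hL) (by generalize L * (M / M₁) = K at hNgap; omega)) hN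
    (touchC_adj_dist hL) hM₁ hL hθ

/-- (2.61) with print's level gap `N = M/M₁` (`L ≥ 2`, `M₁ ≤ M`): `RowSum g σ (K261 (M/M₁) d L 1 σ)` under
`e^{−σ}·L^{2d/(M/M₁)} < 1`. [cite: Balaban1984PropagatorsII, Lemma 2.1 (2.61) p.234; Balaban1989LargeFieldI, p.179, (1.47) p.186] -/
theorem rowSum_touchC_div {σ : ℝ} (ι : g.Site → CubeSite M₁ L Z) (hι : Function.Injective ι)
    (hzone : ∀ y, zoneC (ι y) = g.scale y) (hdist : ∀ y y', g.dist y y' = ((touchC M₁ L Z).dist (ι y) (ι y') : ℝ))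
    (hmono : Monotone Z) (hsep : LayerSepZd Z M L) (ht : Tiles M₁ L Z) (hM₁ : 0 < M₁) (hL : 2 ≤ L) (hMM₁ : M₁ ≤ M)
    (hθ : Real.exp (-σ) * (L : ℝ) ^ ((2 * d : ℝ) / (M / M₁ : ℕ)) < 1) :
    RowSum g σ (K261 (M / M₁) d L 1 σ) := by
  have hn : 0 < M / M₁ := Nat.div_pos hMM₁ hM₁
  refine rowSum_touchC ι hι hzone hdist hmono hsep ht hM₁ (by omega) hn ?_ hθ
  have h2 : 2 * (M / M₁) ≤ L * (M / M₁) := Nat.mul_le_mul_right _ hL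
  generalize M / M₁ = n at h2 hn ⊢
  generalize L * n = K at h2
  omega

/-- **Lemma 2.1 — all four displays (2.60)–(2.63) — for every geometry realised by the touching-cube contours** of a nested
family `Z″_n ⊂ ℤᵈ` with the one-layer separation and the covering (2.4): constant `K261 N d L 1 (αδ₀)` for any `N ≥ 1` with
`N + 1 ≤ L·(M/M₁)`, `RM ≤ N`, under `e^{−αδ₀}·L^{2d/N} < 1` (`δ₀ ≥ 0`, `0 ≤ α ≤ 1`) — `B6Ineq261LevelGap.lemma21_cubeSites` with
`hconn`, `hgap`, `hadj` DISCHARGED. [cite: Balaban1984PropagatorsII, Lemma 2.1 (2.60)–(2.63) p.234, (2.2)–(2.4) p.224; Balaban1989LargeFieldI, p.179, p.186] -/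
theorem lemma21_touchC {δ₀ α : ℝ} (ι : g.Site → CubeSite M₁ L Z) (hι : Function.Injective ι)
    (hzone : ∀ y, zoneC (ι y) = g.scale y) (hdist : ∀ y y', g.dist y y' = ((touchC M₁ L Z).dist (ι y) (ι y') : ℝ))
    (hmono : Monotone Z) (hsep : LayerSepZd Z M L) (ht : Tiles M₁ L Z) (hM₁ : 0 < M₁) (hL : 1 ≤ L)
    (hN : 0 < N) (hNgap : N + 1 ≤ L * (M / M₁)) (hRM : g.R * g.M ≤ N)
    (hδ₀ : 0 ≤ δ₀) (hα0 : 0 ≤ α) (hα1 : α ≤ 1)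
    (hθ : Real.exp (-(α * δ₀)) * (L : ℝ) ^ ((2 * d : ℝ) / N) < 1) :
    B6RandomWalk.Ineq260 g δ₀ α ∧ B6Lemma21Repaired.Ineq261With (K261 N d L 1 (α * δ₀)) g δ₀ α ∧
      B6Lemma21Repaired.Ineq262With (K261 N d L 1 (α * δ₀)) g δ₀ α ∧
      B6Lemma21Repaired.Ineq263With (K261 N d L 1 (α * δ₀)) g δ₀ α :=
  lemma21_cubeSites (touchC M₁ L Z) ι hι hzone hdist (touchC_connected ht hM₁ (by omega))
    (levelGap_of_le (levelGap_touchC_sharp hmono hsep hM₁ hL) (by generalize L * (M / M₁) = K at hNgap; omega)) hN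
    hRM (touchC_adj_dist hL) hM₁ hL hδ₀ hα0 hα1 hθ

/-- Lemma 2.1 with print's level gap `N = M/M₁` (`L ≥ 2`, `M₁ ≤ M`, `RM ≤ M/M₁`). [cite: Balaban1984PropagatorsII, Lemma 2.1 (2.60)–(2.63) p.234; Balaban1989LargeFieldI, p.179, (1.47) p.186] -/
theorem lemma21_touchC_div {δ₀ α : ℝ} (ι : g.Site → CubeSite M₁ L Z) (hι : Function.Injective ι)
    (hzone : ∀ y, zoneC (ι y) = g.scale y) (hdist : ∀ y y', g.dist y y' = ((touchC M₁ L Z).dist (ι y) (ι y') : ℝ))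
    (hmono : Monotone Z) (hsep : LayerSepZd Z M L) (ht : Tiles M₁ L Z) (hM₁ : 0 < M₁) (hL : 2 ≤ L) (hMM₁ : M₁ ≤ M)
    (hRM : g.R * g.M ≤ (M / M₁ : ℕ)) (hδ₀ : 0 ≤ δ₀) (hα0 : 0 ≤ α) (hα1 : α ≤ 1)
    (hθ : Real.exp (-(α * δ₀)) * (L : ℝ) ^ ((2 * d : ℝ) / (M / M₁ : ℕ)) < 1) :
    B6RandomWalk.Ineq260 g δ₀ α ∧ B6Lemma21Repaired.Ineq261With (K261 (M / M₁) d L 1 (α * δ₀)) g δ₀ α ∧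
      B6Lemma21Repaired.Ineq262With (K261 (M / M₁) d L 1 (α * δ₀)) g δ₀ α ∧
      B6Lemma21Repaired.Ineq263With (K261 (M / M₁) d L 1 (α * δ₀)) g δ₀ α := by
  have hn : 0 < M / M₁ := Nat.div_pos hMM₁ hM₁
  refine lemma21_touchC ι hι hzone hdist hmono hsep ht hM₁ (by omega) hn ?_ hRM hδ₀ hα0 hα1 hθ
  have h2 : 2 * (M / M₁) ≤ L * (M / M₁) := Nat.mul_le_mul_right _ hL
  generalize M / M₁ = n at h2 hn ⊢
  generalize L * n = K at h2
  omega

end Instances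

/-! ## §5. The geometry whose sites ARE cube-sites: the named inhabited instance -/

section Geo

/-- **The touching-cube geometry** on a finite set `F` of cube-sites of the ℤᵈ model: `𝔅 = F`, scale = zone (the scale of the
cube), distance = the touching-contour distance (2.46) in the graph `touchC` of ALL cube-sites (contours may leave `F`), the
parameters `k, η, L, R, M` as given; the localisation vocabulary of Props. 2.2–2.8 is not used by Lemma 2.1 and is filled
trivially (as in `B6CoverBox.boxGeo`). [cite: Balaban1984PropagatorsII, (2.1)–(2.4) p.224, (2.45)–(2.46) p.231; Balaban1989LargeFieldI, p.179, p.186] -/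
@[reducible] noncomputable def touchGeo (M₁ L : ℕ) (Z : ℕ → Set (Fin d → ℤ)) (F : Finset (CubeSite M₁ L Z))
    (kk : ℕ) (η R Mr : ℝ) : B6.Geometry where
  Site := ↥F
  fin := inferInstance
  scale := fun y => zoneC y.1
  dist := fun y y' => ((touchC M₁ L Z).dist y.1 y'.1 : ℝ)
  k := kk
  eta := η
  L := L
  R := R
  M := Mr
  Hyp21_22 := True
  Loc := PUnit
  suppIn := fun _ _ => True
  supNorm := fun _ => 0
  l2Norm := fun _ => 0
  holder := fun _ _ => 0
  Cut := PUnit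
  cutIn := fun _ _ => True
  cutH := fun _ _ => 0
  cutSup := fun _ => 0

variable (F : Finset (CubeSite M₁ L Z)) (kk : ℕ) (η R Mr : ℝ)

/-- The touching-cube contour system of `touchGeo` (all cube-sites, bonds `touchC`, the inclusion of `F`, zones = scales).
[cite: Balaban1984PropagatorsII, (2.45)–(2.46) p.231] -/
@[reducible] def touchSystem : ContourSystem (touchGeo M₁ L Z F kk η R Mr) :=
  ⟨CubeSite M₁ L Z, touchC M₁ L Z, Subtype.val, zoneC, fun _ => rfl⟩

/-- Its distance IS (2.46) of that contour system (by construction). [cite: Balaban1984PropagatorsII, (2.46) p.231] -/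
theorem realizes_touchGeo : Realizes (touchGeo M₁ L Z F kk η R Mr) (touchSystem F kk η R Mr) := fun _ _ => rfl

/-- **(2.61) for the touching-cube geometry**, no geometric hypothesis left beyond the shape of `Z″` (`Monotone`, one separating
layer `LayerSepZd Z″ M L`, covering `Tiles`): `RowSum (touchGeo …) σ (K261 N d L 1 σ)` for `N ≥ 1`, `N + 1 ≤ L·(M/M₁)`,
`e^{−σ}·L^{2d/N} < 1`, `M₁ ≥ 1`, `L ≥ 1`. [cite: Balaban1984PropagatorsII, Lemma 2.1 (2.61) p.234; Balaban1989LargeFieldI, p.179, p.186] -/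
theorem rowSum_touchGeo {M N : ℕ} {σ : ℝ} (hmono : Monotone Z) (hsep : LayerSepZd Z M L) (ht : Tiles M₁ L Z)
    (hM₁ : 0 < M₁) (hL : 1 ≤ L) (hN : 0 < N) (hNgap : N + 1 ≤ L * (M / M₁))
    (hθ : Real.exp (-σ) * (L : ℝ) ^ ((2 * d : ℝ) / N) < 1) :
    RowSum (touchGeo M₁ L Z F kk η R Mr) σ (K261 N d L 1 σ) :=
  rowSum_touchC (g := touchGeo M₁ L Z F kk η R Mr) Subtype.val Subtype.val_injective (fun _ => rfl) (fun _ _ => rfl)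
    hmono hsep ht hM₁ hL hN hNgap hθ

/-- **Lemma 2.1 (2.60)–(2.63) for the touching-cube geometry** — the named inhabited instance: for every finite set `F` of
cube-sites of a nested family `Z″_n ⊂ ℤᵈ` with one separating layer of `M·L^{n+1}`-cubes and the covering (2.4), parameters
`R·M_r ≤ N`, `N ≥ 1`, `N + 1 ≤ L·(M/M₁)`, `δ₀ ≥ 0`, `0 ≤ α ≤ 1`, `e^{−αδ₀}·L^{2d/N} < 1`: all four displays with the constant
`K261 N d L 1 (αδ₀)`. [cite: Balaban1984PropagatorsII, Lemma 2.1 (2.60)–(2.63) p.234; Balaban1989LargeFieldI, p.179, p.186] -/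
theorem lemma21_touchGeo {M N : ℕ} {δ₀ α : ℝ} (hmono : Monotone Z) (hsep : LayerSepZd Z M L) (ht : Tiles M₁ L Z)
    (hM₁ : 0 < M₁) (hL : 1 ≤ L) (hN : 0 < N) (hNgap : N + 1 ≤ L * (M / M₁)) (hRM : R * Mr ≤ N)
    (hδ₀ : 0 ≤ δ₀) (hα0 : 0 ≤ α) (hα1 : α ≤ 1)
    (hθ : Real.exp (-(α * δ₀)) * (L : ℝ) ^ ((2 * d : ℝ) / N) < 1) :
    B6RandomWalk.Ineq260 (touchGeo M₁ L Z F kk η R Mr) δ₀ α ∧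
      B6Lemma21Repaired.Ineq261With (K261 N d L 1 (α * δ₀)) (touchGeo M₁ L Z F kk η R Mr) δ₀ α ∧
      B6Lemma21Repaired.Ineq262With (K261 N d L 1 (α * δ₀)) (touchGeo M₁ L Z F kk η R Mr) δ₀ α ∧
      B6Lemma21Repaired.Ineq263With (K261 N d L 1 (α * δ₀)) (touchGeo M₁ L Z F kk η R Mr) δ₀ α :=
  lemma21_touchC (g := touchGeo M₁ L Z F kk η R Mr) Subtype.val Subtype.val_injective (fun _ => rfl) (fun _ _ => rfl)
    hmono hsep ht hM₁ hL hN hNgap hRM hδ₀ hα0 hα1 hθ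

end Geo

/-! ## §6 (v1.1, append-only). The (1.47) p. 186 [IV] walk form for chains of touching cubes, in r12's typed shape -/

section Walk147

variable {M : ℕ}

/-- **The (1.47) input, walk form, for chains of touching cubes** (the sibling of `B15Ineq147LevelGap.walk_length_ge_cube` /
`B15Ineq147Admissible.walk_length_ge_nbr` on the touching-cube graph): a chain of touching cubes from a cube of scale `≤ i`
to a cube NOT contained in `Z″_{j+1}` (e.g. a cube meeting the localisation domain `Ω^c_{j+1}∖Z″_{j+1}`) has at least
`(M/M₁)·(j − i)` bonds — *«by the definition of the domains Z″_i»* (`Monotone Z″`, one separating layer, `M₁ ≥ 1`, `L ≥ 2`).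
[cite: Balaban1989LargeFieldI, (1.47) p.186, p.179; Balaban1984PropagatorsII, (2.46) p.231, (2.57) p.233] -/
theorem walk_length_ge_touchC_Z (hmono : Monotone Z) (hsep : LayerSepZd Z M L) (hM₁ : 0 < M₁) (hL : 2 ≤ L)
    {i j : ℕ} {s t : CubeSite M₁ L Z} (p : (touchC M₁ L Z).Walk s t) (hs : zoneC s ≤ i)
    (ht : ¬ cube M₁ L t.1.1 t.1.2 ⊆ Z (j + 1)) : M / M₁ * (j - i) ≤ p.length := by
  refine walk_length_ge_touchC hmono hsep hM₁ hL p hs ?_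
  by_contra hlt
  exact ht ((t.2.trans Set.sdiff_subset).trans (hmono (by unfold zoneC at hlt; omega)))

/-- **(1.47) p. 186 [IV] for chains of touching cubes**, in r12's typed shape `B15.PrelimIntegrations.Ineq147 δ |Γ| M M₁ (j − i)`
(`exp(−δ|Γ|) ≤ exp(−δ(M/M₁)(j − i))`, `δ ≥ 0`, `M₁ ∣ M`), `|Γ|` the number of bonds of any such chain.
[cite: Balaban1989LargeFieldI, (1.47) p.186] -/
theorem ineq147_walk_touchC (hmono : Monotone Z) (hsep : LayerSepZd Z M L) (hM₁ : 0 < M₁) (hdvd : M₁ ∣ M) (hL : 2 ≤ L)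
    {i j : ℕ} {s t : CubeSite M₁ L Z} (p : (touchC M₁ L Z).Walk s t) (hs : zoneC s ≤ i)
    (ht : ¬ cube M₁ L t.1.1 t.1.2 ⊆ Z (j + 1)) {δ : ℝ} (hδ : 0 ≤ δ) :
    B15.PrelimIntegrations.Ineq147 δ (p.length : ℝ) M M₁ ((j - i : ℕ) : ℝ) := by
  have h := walk_length_ge_touchC_Z hmono hsep hM₁ hL p hs ht
  have hM₁' : (0 : ℝ) < M₁ := by exact_mod_cast hM₁
  have hcast : ((M / M₁ : ℕ) : ℝ) = (M : ℝ) / M₁ := Nat.cast_div hdvd hM₁'.ne'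
  have h' : (M : ℝ) / M₁ * ((j - i : ℕ) : ℝ) ≤ (p.length : ℝ) := by
    rw [← hcast]
    exact_mod_cast h
  exact B15.PrelimIntegrations.ineq147_of_dist (by nlinarith [h', hδ])

/-- **The distance form**: under the covering `Tiles` (so that every two cube-sites are joined by a chain of touching cubes) the
touching-contour distance from a cube of scale `≤ i` to a cube not inside `Z″_{j+1}` is at least `(M/M₁)(j − i)` — the
geometric input *«d(y, Ω^c_{j+1}∖Z″_{j+1}) ≥ (M/M₁)(j − i)»* of (1.47) on the model, hypothesis-free beyond the printed shape
of `Z″`. [cite: Balaban1989LargeFieldI, (1.47) p.186, p.179; Balaban1984PropagatorsII, (2.4) p.224, (2.46) p.231] -/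
theorem dist_ge_touchC_Z (hmono : Monotone Z) (hsep : LayerSepZd Z M L) (ht0 : Tiles M₁ L Z) (hM₁ : 0 < M₁)
    (hL : 2 ≤ L) {i j : ℕ} {s t : CubeSite M₁ L Z} (hs : zoneC s ≤ i) (ht : ¬ cube M₁ L t.1.1 t.1.2 ⊆ Z (j + 1)) :
    M / M₁ * (j - i) ≤ (touchC M₁ L Z).dist s t := by
  obtain ⟨p, hp⟩ := ((touchC_connected ht0 hM₁ (by omega)).preconnected s t).exists_walk_length_eq_dist
  rw [← hp]
  exact walk_length_ge_touchC_Z hmono hsep hM₁ hL p hs ht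

/-- The walk form for every [III] (2.13)-admissible sequence `D` (`Z″ = Dᶜ`): a chain of touching cubes from a bond cube of
scale `≤ i` to a bond cube containing a point of `D (j+1) = Ω″_{j+1}` has at least `(M/M₁)(j − i)` bonds; no geometric
hypothesis left (`M₁ ∣ M` not even needed here; `M ≥ 1`, `L ≥ 2`). [cite: Balaban1989LargeFieldI, (1.47) p.186, p.179; Balaban1988Convergent, (2.13) p.256] -/
theorem walk_length_ge_touchC_admissible {D : ℕ → Set (Fin d → ℤ)}
    (hdistD : ∀ n, ∀ x ∈ D (n + 1), ∀ y,
      Within ((B14.Eq213MaximalDomains.side L M (n + 1) : ℤ) - 1) x y → y ∈ D n)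
    (hM₁ : 0 < M₁) (hM : 0 < M) (hL : 2 ≤ L) {i j : ℕ}
    {s t : CubeSite M₁ L (fun n => (D n)ᶜ)} (p : (touchC M₁ L (fun n => (D n)ᶜ)).Walk s t) (hs : zoneC s ≤ i)
    (ht : ∃ x ∈ cube M₁ L t.1.1 t.1.2, x ∈ D (j + 1)) : M / M₁ * (j - i) ≤ p.length := by
  refine walk_length_ge_touchC_Z (monotone_compl_of_admissible (by omega) hM hdistD) (layerSepZd_of_admissible hdistD)
    hM₁ hL p hs ?_
  rintro hsub
  obtain ⟨x, hx, hxD⟩ := ht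
  exact hsub hx hxD

end Walk147

end Literature.MathematicalPhysics.QuantumFieldTheory.Balaban1983to89.B15TouchingCubeContours
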